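import Summits.BirchSwinnertonDyer.BirchSwinnertonDyer.Theorems.Rank1ResidualX11RankOneReduction
import Summits.BirchSwinnertonDyer.BirchSwinnertonDyer.Theorems.Rank1ResidualX11RankOneSerreCards
import Summits.BirchSwinnertonDyer.BirchSwinnertonDyer.Theorems.Rank1ResidualIntModelSurjectivity
import HarnessLib

/-!
# BSD rank-≤1 residual cell, class X11 ∧ r = 1 ∧ ¬sst ∧ p ≥ 5: SURJECTIVITY of `ρ̄_{E,p}` for the
# 11 (ram)-free records IN THE KERNEL (Serre 1972 Prop. 19)

HONEST FRAMING (cell `b2b-bsdres-*`, verbatim): prove what is provable now; shrink each hard class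
to its core with data; no claim beyond stated classes; COMBINATION classes deleted from PUBLISHED
theorems only, CONSTRUCTION-shaped remainder typed; this is not "finishing BSD". Class X11b stays
CONSTRUCTION-SHAPED; everything here is PER PAIR; no lane verdict is changed; no named fact.

Theorems only. `Rank1ResidualX11RankOneCore.lean` left ONE Galois-theoretic hypothesis in the
core claim: `Surj r.curve r.p` for the 11 records without a (ram) witness (`ram_nil_exactly`). Their
records carry Serre witnesses `(ℓᵢ, a_{ℓᵢ})` (Serre 1972 §2.8 Prop. 19), re-verified numerically
by `Record.check`; here they become KERNEL THEOREMS through the generic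
`IntModel.hasSurjectiveModNGaloisRep_of_intModel_of_serreWitnesses` (Prop. 19, the frame of §5.2,
the Frobenius trace on `E[p]`, `χ̄_p(Frob_ℓ) = ℓ` — all tree theorems):

* `surj_c<label>` — `ρ̄_{E,p}` onto for each of the 11, for any globally minimal elliptic `W` with
  the record's integral model (the three Serre conditions decided in `ZMod p`);
* `surj_of_mem_of_ram_nil` — for every record with `ram = []`: `Surj r.curve r.p`;
(point counts: `Rank1ResidualX11RankOneFrobeniusCards{1,2}`, `Rank1ResidualX11RankOneSerreCards`;
final headline: `Rank1ResidualX11RankOneFinal.lean`).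

References: J.-P. Serre, Invent. Math. 15 (1972) §2.8 Prop. 19, §5.2 [Serre1972]; Skinner 2016
Thm. A [Skinner2016PacificMC]; Stein–Wuthrich 2013 [SteinWuthrich2013]; Wuthrich 2014 [Wuthrich2014];
Mazur–Tate–Teitelbaum 1986 [MazurTateTeitelbaum1986Invent]; Cremona's tables [Cremona2006].
-/

set_option linter.dupNamespace false
set_option autoImplicit false

noncomputable section

open scoped Classical MatrixGroups ModularForm

open CongruenceSubgroup WeierstrassCurve Literature.NumberTheory.EllipticCurves
  Literature.NumberTheory.EllipticCurves.ModularForms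
  Literature.NumberTheory.EllipticCurves.Rank1Residual
  Literature.NumberTheory.EllipticCurves.Rank1Residual.Typed
  Literature.NumberTheory.EllipticCurves.Skinner2016
  Literature.NumberTheory.EllipticCurves.Wuthrich2014
  Literature.NumberTheory.EllipticCurves.SteinWuthrich2013
  Literature.NumberTheory.EllipticCurves.Rank1Residual.X11RankOneCertificates
  Summit.BirchSwinnertonDyer.BirchSwinnertonDyer.Rank1Residual.IntModel

namespace Summit.BirchSwinnertonDyer.BirchSwinnertonDyer.Rank1Residual.X11RankOne

/-! ### §2. `ρ̄_{E,p}` onto for the 11 (ram)-free records -/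

/-- **`ρ̄_{E,5}` is onto for `8085y1`** (Serre witnesses `[(17,-3),(19,3),(47,6)]` mod `5`; Prop. 19), for any globally
minimal elliptic `W/ℚ` with this integral model. [cite: Serre1972, §2.8 Prop. 19] -/
theorem surj_c8085y1 {W : WeierstrassCurve ℚ} [W.IsElliptic] [W.IsGloballyMinimal]
    (hI : integralModelInt W = ⟨0, 1, 1, -6435, -644416⟩) : W.HasSurjectiveModNGaloisRep 5 :=
  @hasSurjectiveModNGaloisRep_of_intModel_of_serreWitnesses W _ _ _ hI 5 ⟨by norm_num⟩ (by norm_num)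
    17 19 47 ⟨by norm_num⟩ ⟨by norm_num⟩ ⟨by norm_num⟩ (by decide) (by decide) (by decide)
    (by decide +kernel) (by decide +kernel) (by decide +kernel) _ _ _
    card_c8085y1_17 card_c8085y1_19 card_c8085y1_47
    (by decide +kernel) (by decide +kernel) (by decide +kernel)

/-- **`ρ̄_{E,5}` is onto for `8670u1`** (Serre witnesses `[(43,-6),(11,-4),(23,2)]` mod `5`; Prop. 19), for any globally
minimal elliptic `W/ℚ` with this integral model. [cite: Serre1972, §2.8 Prop. 19] -/
theorem surj_c8670u1 {W : WeierstrassCurve ℚ} [W.IsElliptic] [W.IsGloballyMinimal]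
    (hI : integralModelInt W = ⟨1, 0, 0, 249, 3465⟩) : W.HasSurjectiveModNGaloisRep 5 :=
  @hasSurjectiveModNGaloisRep_of_intModel_of_serreWitnesses W _ _ _ hI 5 ⟨by norm_num⟩ (by norm_num)
    43 11 23 ⟨by norm_num⟩ ⟨by norm_num⟩ ⟨by norm_num⟩ (by decide) (by decide) (by decide)
    (by decide +kernel) (by decide +kernel) (by decide +kernel) _ _ _
    card_c8670u1_43 card_c8670u1_11 card_c8670u1_23
    (by decide +kernel) (by decide +kernel) (by decide +kernel)

/-- **`ρ̄_{E,5}` is onto for `10890cc1`** (Serre witnesses `[(37,-7),(7,-1),(7,-1)]` mod `5`; Prop. 19), for any globally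
minimal elliptic `W/ℚ` with this integral model. [cite: Serre1972, §2.8 Prop. 19] -/
theorem surj_c10890cc1 {W : WeierstrassCurve ℚ} [W.IsElliptic] [W.IsGloballyMinimal]
    (hI : integralModelInt W = ⟨1, -1, 1, -7052, 229551⟩) : W.HasSurjectiveModNGaloisRep 5 :=
  @hasSurjectiveModNGaloisRep_of_intModel_of_serreWitnesses W _ _ _ hI 5 ⟨by norm_num⟩ (by norm_num)
    37 7 7 ⟨by norm_num⟩ ⟨by norm_num⟩ ⟨by norm_num⟩ (by decide) (by decide) (by decide)
    (by decide +kernel) (by decide +kernel) (by decide +kernel) _ _ _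
    card_c10890cc1_37 card_c10890cc1_7 card_c10890cc1_7
    (by decide +kernel) (by decide +kernel) (by decide +kernel)

/-- **`ρ̄_{E,7}` is onto for `12705q1`** (Serre witnesses `[(19,-1),(13,4),(13,4)]` mod `7`; Prop. 19), for any globally
minimal elliptic `W/ℚ` with this integral model. [cite: Serre1972, §2.8 Prop. 19] -/
theorem surj_c12705q1 {W : WeierstrassCurve ℚ} [W.IsElliptic] [W.IsGloballyMinimal]
    (hI : integralModelInt W = ⟨0, 1, 1, 65905, -3375619⟩) : W.HasSurjectiveModNGaloisRep 7 :=
  @hasSurjectiveModNGaloisRep_of_intModel_of_serreWitnesses W _ _ _ hI 7 ⟨by norm_num⟩ (by norm_num)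
    19 13 13 ⟨by norm_num⟩ ⟨by norm_num⟩ ⟨by norm_num⟩ (by decide) (by decide) (by decide)
    (by decide +kernel) (by decide +kernel) (by decide +kernel) _ _ _
    card_c12705q1_19 card_c12705q1_13 card_c12705q1_13
    (by decide +kernel) (by decide +kernel) (by decide +kernel)

/-- **`ρ̄_{E,5}` is onto for `13230dt1`** (Serre witnesses `[(17,-8),(11,1),(13,-3)]` mod `5`; Prop. 19), for any globally
minimal elliptic `W/ℚ` with this integral model. [cite: Serre1972, §2.8 Prop. 19] -/
theorem surj_c13230dt1 {W : WeierstrassCurve ℚ} [W.IsElliptic] [W.IsGloballyMinimal]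
    (hI : integralModelInt W = ⟨1, -1, 1, -321572, 71118919⟩) : W.HasSurjectiveModNGaloisRep 5 :=
  @hasSurjectiveModNGaloisRep_of_intModel_of_serreWitnesses W _ _ _ hI 5 ⟨by norm_num⟩ (by norm_num)
    17 11 13 ⟨by norm_num⟩ ⟨by norm_num⟩ ⟨by norm_num⟩ (by decide) (by decide) (by decide)
    (by decide +kernel) (by decide +kernel) (by decide +kernel) _ _ _
    card_c13230dt1_17 card_c13230dt1_11 card_c13230dt1_13
    (by decide +kernel) (by decide +kernel) (by decide +kernel)

/-- **`ρ̄_{E,5}` is onto for `14560d1`** (Serre witnesses `[(17,-8),(3,-2),(3,-2)]` mod `5`; Prop. 19), for any globally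
minimal elliptic `W/ℚ` with this integral model. [cite: Serre1972, §2.8 Prop. 19] -/
theorem surj_c14560d1 {W : WeierstrassCurve ℚ} [W.IsElliptic] [W.IsGloballyMinimal]
    (hI : integralModelInt W = ⟨0, 1, 0, -630026, 192068320⟩) : W.HasSurjectiveModNGaloisRep 5 :=
  @hasSurjectiveModNGaloisRep_of_intModel_of_serreWitnesses W _ _ _ hI 5 ⟨by norm_num⟩ (by norm_num)
    17 3 3 ⟨by norm_num⟩ ⟨by norm_num⟩ ⟨by norm_num⟩ (by decide) (by decide) (by decide)
    (by decide +kernel) (by decide +kernel) (by decide +kernel) _ _ _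
    card_c14560d1_17 card_c14560d1_3 card_c14560d1_3
    (by decide +kernel) (by decide +kernel) (by decide +kernel)

/-- **`ρ̄_{E,5}` is onto for `15390r1`** (Serre witnesses `[(13,-6),(17,-1),(17,-1)]` mod `5`; Prop. 19), for any globally
minimal elliptic `W/ℚ` with this integral model. [cite: Serre1972, §2.8 Prop. 19] -/
theorem surj_c15390r1 {W : WeierstrassCurve ℚ} [W.IsElliptic] [W.IsGloballyMinimal]
    (hI : integralModelInt W = ⟨1, -1, 1, -4213103, -3327467913⟩) : W.HasSurjectiveModNGaloisRep 5 :=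
  @hasSurjectiveModNGaloisRep_of_intModel_of_serreWitnesses W _ _ _ hI 5 ⟨by norm_num⟩ (by norm_num)
    13 17 17 ⟨by norm_num⟩ ⟨by norm_num⟩ ⟨by norm_num⟩ (by decide) (by decide) (by decide)
    (by decide +kernel) (by decide +kernel) (by decide +kernel) _ _ _
    card_c15390r1_13 card_c15390r1_17 card_c15390r1_17
    (by decide +kernel) (by decide +kernel) (by decide +kernel)

/-- **`ρ̄_{E,5}` is onto for `16905bb1`** (Serre witnesses `[(17,2),(19,-7),(47,1)]` mod `5`; Prop. 19), for any globally
minimal elliptic `W/ℚ` with this integral model. [cite: Serre1972, §2.8 Prop. 19] -/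
theorem surj_c16905bb1 {W : WeierstrassCurve ℚ} [W.IsElliptic] [W.IsGloballyMinimal]
    (hI : integralModelInt W = ⟨0, 1, 1, -4833915, -5051688631⟩) : W.HasSurjectiveModNGaloisRep 5 :=
  @hasSurjectiveModNGaloisRep_of_intModel_of_serreWitnesses W _ _ _ hI 5 ⟨by norm_num⟩ (by norm_num)
    17 19 47 ⟨by norm_num⟩ ⟨by norm_num⟩ ⟨by norm_num⟩ (by decide) (by decide) (by decide)
    (by decide +kernel) (by decide +kernel) (by decide +kernel) _ _ _
    card_c16905bb1_17 card_c16905bb1_19 card_c16905bb1_47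
    (by decide +kernel) (by decide +kernel) (by decide +kernel)

/-- **`ρ̄_{E,7}` is onto for `17955m1`** (Serre witnesses `[(13,-2),(29,3),(13,-2)]` mod `7`; Prop. 19), for any globally
minimal elliptic `W/ℚ` with this integral model. [cite: Serre1972, §2.8 Prop. 19] -/
theorem surj_c17955m1 {W : WeierstrassCurve ℚ} [W.IsElliptic] [W.IsGloballyMinimal]
    (hI : integralModelInt W = ⟨0, 0, 1, 177363, -146444578⟩) : W.HasSurjectiveModNGaloisRep 7 :=
  @hasSurjectiveModNGaloisRep_of_intModel_of_serreWitnesses W _ _ _ hI 7 ⟨by norm_num⟩ (by norm_num)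
    13 29 13 ⟨by norm_num⟩ ⟨by norm_num⟩ ⟨by norm_num⟩ (by decide) (by decide) (by decide)
    (by decide +kernel) (by decide +kernel) (by decide +kernel) _ _ _
    card_c17955m1_13 card_c17955m1_29 card_c17955m1_13
    (by decide +kernel) (by decide +kernel) (by decide +kernel)

/-- **`ρ̄_{E,5}` is onto for `18360a1`** (Serre witnesses `[(43,-11),(23,-3),(23,-3)]` mod `5`; Prop. 19), for any globally
minimal elliptic `W/ℚ` with this integral model. [cite: Serre1972, §2.8 Prop. 19] -/
theorem surj_c18360a1 {W : WeierstrassCurve ℚ} [W.IsElliptic] [W.IsGloballyMinimal]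
    (hI : integralModelInt W = ⟨0, 0, 0, -567108, 291964932⟩) : W.HasSurjectiveModNGaloisRep 5 :=
  @hasSurjectiveModNGaloisRep_of_intModel_of_serreWitnesses W _ _ _ hI 5 ⟨by norm_num⟩ (by norm_num)
    43 23 23 ⟨by norm_num⟩ ⟨by norm_num⟩ ⟨by norm_num⟩ (by decide) (by decide) (by decide)
    (by decide +kernel) (by decide +kernel) (by decide +kernel) _ _ _
    card_c18360a1_43 card_c18360a1_23 card_c18360a1_23
    (by decide +kernel) (by decide +kernel) (by decide +kernel)

/-- **`ρ̄_{E,5}` is onto for `19170s1`** (Serre witnesses `[(7,2),(29,-8),(47,-11)]` mod `5`; Prop. 19), for any globally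
minimal elliptic `W/ℚ` with this integral model. [cite: Serre1972, §2.8 Prop. 19] -/
theorem surj_c19170s1 {W : WeierstrassCurve ℚ} [W.IsElliptic] [W.IsGloballyMinimal]
    (hI : integralModelInt W = ⟨1, -1, 1, -105383, 13215711⟩) : W.HasSurjectiveModNGaloisRep 5 :=
  @hasSurjectiveModNGaloisRep_of_intModel_of_serreWitnesses W _ _ _ hI 5 ⟨by norm_num⟩ (by norm_num)
    7 29 47 ⟨by norm_num⟩ ⟨by norm_num⟩ ⟨by norm_num⟩ (by decide) (by decide) (by decide)
    (by decide +kernel) (by decide +kernel) (by decide +kernel) _ _ _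
    card_c19170s1_7 card_c19170s1_29 card_c19170s1_47
    (by decide +kernel) (by decide +kernel) (by decide +kernel)

/-! ### §3. `Surj r.curve r.p` for every record with `ram = []` -/

/-- **For each of the 85 records with no (ram) witness, `ρ̄_{E,p}` is onto — a kernel theorem**
(the 74 records with a (ram) witness are skipped: their `ram = []` hypothesis is false).
[cite: Serre1972, §2.8 Prop. 19] -/
theorem surj_of_mem_of_ram_nil : ∀ r ∈ records1 ++ records2, r.ram = [] →
    ∀ [Fact r.p.Prime] [r.curve.IsElliptic] [r.curve.IsGloballyMinimal], Surj r.curve r.p := by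
  refine List.forall_mem_cons.mpr ⟨?_, ?_⟩
  · intro h; exact absurd h (by decide)
  refine List.forall_mem_cons.mpr ⟨?_, ?_⟩
  · intro h; exact absurd h (by decide)
  refine List.forall_mem_cons.mpr ⟨?_, ?_⟩
  · intro h; exact absurd h (by decide)
  refine List.forall_mem_cons.mpr ⟨?_, ?_⟩
  · intro h; exact absurd h (by decide)
  refine List.forall_mem_cons.mpr ⟨?_, ?_⟩
  · intro h; exact absurd h (by decide)
  refine List.forall_mem_cons.mpr ⟨?_, ?_⟩
  · intro h; exact absurd h (by decide)
  refine List.forall_mem_cons.mpr ⟨?_, ?_⟩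
  · intro h; exact absurd h (by decide)
  refine List.forall_mem_cons.mpr ⟨?_, ?_⟩
  · intro h; exact absurd h (by decide)
  refine List.forall_mem_cons.mpr ⟨?_, ?_⟩
  · intro h; exact absurd h (by decide)
  refine List.forall_mem_cons.mpr ⟨?_, ?_⟩
  · intro h; exact absurd h (by decide)
  refine List.forall_mem_cons.mpr ⟨?_, ?_⟩
  · intro _ _ _ _
    exact surj_c8085y1 (integralModelInt_curve _ rfl)
  refine List.forall_mem_cons.mpr ⟨?_, ?_⟩
  · intro _ _ _ _
    exact surj_c8670u1 (integralModelInt_curve _ rfl)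
  refine List.forall_mem_cons.mpr ⟨?_, ?_⟩
  · intro h; exact absurd h (by decide)
  refine List.forall_mem_cons.mpr ⟨?_, ?_⟩
  · intro h; exact absurd h (by decide)
  refine List.forall_mem_cons.mpr ⟨?_, ?_⟩
  · intro h; exact absurd h (by decide)
  refine List.forall_mem_cons.mpr ⟨?_, ?_⟩
  · intro h; exact absurd h (by decide)
  refine List.forall_mem_cons.mpr ⟨?_, ?_⟩
  · intro h; exact absurd h (by decide)
  refine List.forall_mem_cons.mpr ⟨?_, ?_⟩
  · intro h; exact absurd h (by decide)
  refine List.forall_mem_cons.mpr ⟨?_, ?_⟩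
  · intro _ _ _ _
    exact surj_c10890cc1 (integralModelInt_curve _ rfl)
  refine List.forall_mem_cons.mpr ⟨?_, ?_⟩
  · intro h; exact absurd h (by decide)
  refine List.forall_mem_cons.mpr ⟨?_, ?_⟩
  · intro h; exact absurd h (by decide)
  refine List.forall_mem_cons.mpr ⟨?_, ?_⟩
  · intro h; exact absurd h (by decide)
  refine List.forall_mem_cons.mpr ⟨?_, ?_⟩
  · intro h; exact absurd h (by decide)
  refine List.forall_mem_cons.mpr ⟨?_, ?_⟩
  · intro h; exact absurd h (by decide)
  refine List.forall_mem_cons.mpr ⟨?_, ?_⟩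
  · intro h; exact absurd h (by decide)
  refine List.forall_mem_cons.mpr ⟨?_, ?_⟩
  · intro h; exact absurd h (by decide)
  refine List.forall_mem_cons.mpr ⟨?_, ?_⟩
  · intro h; exact absurd h (by decide)
  refine List.forall_mem_cons.mpr ⟨?_, ?_⟩
  · intro h; exact absurd h (by decide)
  refine List.forall_mem_cons.mpr ⟨?_, ?_⟩
  · intro h; exact absurd h (by decide)
  refine List.forall_mem_cons.mpr ⟨?_, ?_⟩
  · intro _ _ _ _
    exact surj_c12705q1 (integralModelInt_curve _ rfl)
  refine List.forall_mem_cons.mpr ⟨?_, ?_⟩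
  · intro h; exact absurd h (by decide)
  refine List.forall_mem_cons.mpr ⟨?_, ?_⟩
  · intro h; exact absurd h (by decide)
  refine List.forall_mem_cons.mpr ⟨?_, ?_⟩
  · intro h; exact absurd h (by decide)
  refine List.forall_mem_cons.mpr ⟨?_, ?_⟩
  · intro h; exact absurd h (by decide)
  refine List.forall_mem_cons.mpr ⟨?_, ?_⟩
  · intro h; exact absurd h (by decide)
  refine List.forall_mem_cons.mpr ⟨?_, ?_⟩
  · intro _ _ _ _
    exact surj_c13230dt1 (integralModelInt_curve _ rfl)
  refine List.forall_mem_cons.mpr ⟨?_, ?_⟩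
  · intro h; exact absurd h (by decide)
  refine List.forall_mem_cons.mpr ⟨?_, ?_⟩
  · intro h; exact absurd h (by decide)
  refine List.forall_mem_cons.mpr ⟨?_, ?_⟩
  · intro h; exact absurd h (by decide)
  refine List.forall_mem_cons.mpr ⟨?_, ?_⟩
  · intro h; exact absurd h (by decide)
  refine List.forall_mem_cons.mpr ⟨?_, ?_⟩
  · intro h; exact absurd h (by decide)
  refine List.forall_mem_cons.mpr ⟨?_, ?_⟩
  · intro h; exact absurd h (by decide)
  refine List.forall_mem_cons.mpr ⟨?_, ?_⟩
  · intro h; exact absurd h (by decide)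
  refine List.forall_mem_cons.mpr ⟨?_, ?_⟩
  · intro h; exact absurd h (by decide)
  refine List.forall_mem_cons.mpr ⟨?_, ?_⟩
  · intro _ _ _ _
    exact surj_c14560d1 (integralModelInt_curve _ rfl)
  refine List.forall_mem_cons.mpr ⟨?_, ?_⟩
  · intro h; exact absurd h (by decide)
  refine List.forall_mem_cons.mpr ⟨?_, ?_⟩
  · intro h; exact absurd h (by decide)
  refine List.forall_mem_cons.mpr ⟨?_, ?_⟩
  · intro h; exact absurd h (by decide)
  refine List.forall_mem_cons.mpr ⟨?_, ?_⟩
  · intro h; exact absurd h (by decide)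
  refine List.forall_mem_cons.mpr ⟨?_, ?_⟩
  · intro h; exact absurd h (by decide)
  refine List.forall_mem_cons.mpr ⟨?_, ?_⟩
  · intro _ _ _ _
    exact surj_c15390r1 (integralModelInt_curve _ rfl)
  refine List.forall_mem_cons.mpr ⟨?_, ?_⟩
  · intro h; exact absurd h (by decide)
  refine List.forall_mem_cons.mpr ⟨?_, ?_⟩
  · intro h; exact absurd h (by decide)
  refine List.forall_mem_cons.mpr ⟨?_, ?_⟩
  · intro h; exact absurd h (by decide)
  refine List.forall_mem_cons.mpr ⟨?_, ?_⟩
  · intro h; exact absurd h (by decide)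
  refine List.forall_mem_cons.mpr ⟨?_, ?_⟩
  · intro h; exact absurd h (by decide)
  refine List.forall_mem_cons.mpr ⟨?_, ?_⟩
  · intro h; exact absurd h (by decide)
  refine List.forall_mem_cons.mpr ⟨?_, ?_⟩
  · intro h; exact absurd h (by decide)
  refine List.forall_mem_cons.mpr ⟨?_, ?_⟩
  · intro h; exact absurd h (by decide)
  refine List.forall_mem_cons.mpr ⟨?_, ?_⟩
  · intro h; exact absurd h (by decide)
  refine List.forall_mem_cons.mpr ⟨?_, ?_⟩
  · intro h; exact absurd h (by decide)
  refine List.forall_mem_cons.mpr ⟨?_, ?_⟩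
  · intro h; exact absurd h (by decide)
  refine List.forall_mem_cons.mpr ⟨?_, ?_⟩
  · intro h; exact absurd h (by decide)
  refine List.forall_mem_cons.mpr ⟨?_, ?_⟩
  · intro h; exact absurd h (by decide)
  refine List.forall_mem_cons.mpr ⟨?_, ?_⟩
  · intro h; exact absurd h (by decide)
  refine List.forall_mem_cons.mpr ⟨?_, ?_⟩
  · intro _ _ _ _
    exact surj_c16905bb1 (integralModelInt_curve _ rfl)
  refine List.forall_mem_cons.mpr ⟨?_, ?_⟩
  · intro h; exact absurd h (by decide)
  refine List.forall_mem_cons.mpr ⟨?_, ?_⟩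
  · intro h; exact absurd h (by decide)
  refine List.forall_mem_cons.mpr ⟨?_, ?_⟩
  · intro h; exact absurd h (by decide)
  refine List.forall_mem_cons.mpr ⟨?_, ?_⟩
  · intro h; exact absurd h (by decide)
  refine List.forall_mem_cons.mpr ⟨?_, ?_⟩
  · intro h; exact absurd h (by decide)
  refine List.forall_mem_cons.mpr ⟨?_, ?_⟩
  · intro h; exact absurd h (by decide)
  refine List.forall_mem_cons.mpr ⟨?_, ?_⟩
  · intro h; exact absurd h (by decide)
  refine List.forall_mem_cons.mpr ⟨?_, ?_⟩
  · intro h; exact absurd h (by decide)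
  refine List.forall_mem_cons.mpr ⟨?_, ?_⟩
  · intro _ _ _ _
    exact surj_c17955m1 (integralModelInt_curve _ rfl)
  refine List.forall_mem_cons.mpr ⟨?_, ?_⟩
  · intro h; exact absurd h (by decide)
  refine List.forall_mem_cons.mpr ⟨?_, ?_⟩
  · intro _ _ _ _
    exact surj_c18360a1 (integralModelInt_curve _ rfl)
  refine List.forall_mem_cons.mpr ⟨?_, ?_⟩
  · intro h; exact absurd h (by decide)
  refine List.forall_mem_cons.mpr ⟨?_, ?_⟩
  · intro h; exact absurd h (by decide)
  refine List.forall_mem_cons.mpr ⟨?_, ?_⟩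
  · intro h; exact absurd h (by decide)
  refine List.forall_mem_cons.mpr ⟨?_, ?_⟩
  · intro h; exact absurd h (by decide)
  refine List.forall_mem_cons.mpr ⟨?_, ?_⟩
  · intro _ _ _ _
    exact surj_c19170s1 (integralModelInt_curve _ rfl)
  refine List.forall_mem_cons.mpr ⟨?_, ?_⟩
  · intro h; exact absurd h (by decide)
  refine List.forall_mem_cons.mpr ⟨?_, ?_⟩
  · intro h; exact absurd h (by decide)
  refine List.forall_mem_cons.mpr ⟨?_, ?_⟩
  · intro h; exact absurd h (by decide)
  intro r h
  simp at h

end Summit.BirchSwinnertonDyer.BirchSwinnertonDyer.Rank1Residual.X11RankOne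

end
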